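import Mathlib
import HarnessLib
import Literature.Combinatorics.SimpleGraph.EliminationGraph
import Literature.Probability.LatticeModels.LatticeGraph

/-!
# LatticeQCDFlow / Scaling — the elimination-front law is SHARP IN THE EXPONENT: the folded raster
# order of `(ℤ/L)^d` has every fill neighbourhood of size `≤ 2·L^{d-1}`; `tw((ℤ/L)^d) ≤ 2·L^{d-1}`

HONEST FRAMING: exact (Metropolis-corrected) sampling algorithms for lattice gauge theory;
figures of merit are autocorrelation/cost numbers at stated couplings and volumes; no
continuum-physics claim.

Venture `LatticeQCDFlow` (cell pub-lqcd), topic `Scaling`, FANOUT row 30 (lean-1) — OUR WORK, the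
UPPER half of the AUTOREGRESSIVE-CONTEXT (ELIMINATION-FRONT) VOLUME LAW (THEORY-2.md §4 row T2-AF
(a): "exact autoregressive maps exist with per-component context `≤ 3·L^{d-1}`").  A BANDWIDTH
argument: if an injective integer labelling `rank` of the vertices changes by at most `β` across
every edge, then in the order it induces every higher fill-neighbourhood `adj⁺_*(v)` lies in
`{w | rank v < rank w ≤ rank v + β}` (a fill neighbour of `v` is adjacent to a vertex `≤ v`: the
last edge of the lower path, [VA15, Thm 6.1]), so `elimWidth ≤ β` (`elimWidth_le_of_bandwidth`).
On the torus `(ℤ/L)^d` the FOLDED RASTER labelling `rank x = Σ_i φ(x_i)·L^i`, with the folding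
`φ : ℤ/L → {0,…,L-1}`, `φ = (0, L-1, 1, L-2, 2, …)⁻¹` — i.e. `φ(t) = 2t` for `2t ≤ L-1` and
`φ(t) = 2(L-1-t)+1` otherwise — moves by at most `2·L^i ≤ 2·L^{d-1}` across an edge in direction
`i` INCLUDING the wrap-around edge (`abs_foldVal_sub_le_two`), whence

* **`torus_elimWidth_foldedRaster_le`** — in the folded raster order every site has at most
  `2·L^{d-1}` higher fill-neighbours (`d ≥ 1`, `L ≥ 2`);
* **`torus_treewidth_le`** — `tw((ℤ/L)^d) ≤ 2·L^{d-1}`.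
With `Scaling/EliminationFrontTorus.lean` (`c_d·L^{d-1} ≤ elimWidth` for EVERY order,
`c_d·L^{d-1} ≤ tw`): the minimal largest context of an exact autoregressive sampler of a nearest-
neighbour Markov / free field on the periodic lattice is `Θ(L^{d-1})` — a full cross-section, no
more and no less.  Elementary; nothing is cited as a fact; `def`s `foldVal`, `foldedRank`,
`foldedRasterOrder`; no `sorry`.
-/

namespace Summit.Ventures.LatticeQCDFlow.Theory2.Autoregressive

open Finset Function
open Literature.Probability.LatticeModels (TorusSite torusGraph torusGraph_adj_iff)
open Literature.Combinatorics.SimpleGraph Literature.LinearAlgebra.Matrix.ChordalSparsity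

/-! ## 1. Bandwidth bounds the elimination width -/

section Bandwidth

variable {V : Type*} [LinearOrder V] [Fintype V] {G : SimpleGraph V}

omit [Fintype V] in
/-- A higher fill-neighbour `w` of `v` (a lower path from `v` to `w`) is above `v` and adjacent to a
vertex `u ≤ v` — the last interior vertex of the path, or `v` itself. [folklore] -/
theorem exists_adj_le_of_mem_higherAdj {v w : V} (hw : w ∈ higherAdj (elimGraph G).Adj v) :
    v < w ∧ ∃ u, u ≤ v ∧ G.Adj u w := by
  obtain ⟨hvw, hadj⟩ := mem_higherAdj_iff.mp hw
  obtain ⟨hne, p, hp⟩ := elimGraph_adj_iff.mp hadj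
  refine ⟨hvw, ?_⟩
  -- the last edge of `p`: read on the reversed walk `w → … → v`
  have hlen : 0 < p.reverse.length := by
    rw [SimpleGraph.Walk.length_reverse]
    by_contra h0
    exact hne (p.eq_of_length_eq_zero (by omega))
  have hadj' : G.Adj w (p.reverse.getVert 1) := by
    have := p.reverse.adj_getVert_succ hlen
    rwa [SimpleGraph.Walk.getVert_zero] at this
  set u := p.reverse.getVert 1
  have hu : u ∈ p.support := by
    have := p.reverse.getVert_mem_support 1
    rwa [SimpleGraph.Walk.support_reverse, List.mem_reverse] at this
  refine ⟨u, ?_, hadj'.symm⟩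
  rcases hp u hu with h | h | h
  · exact h.le
  · exact absurd h.symm hadj'.ne
  · exact h.1.le

/-- **Bandwidth bound**: if `rank : V → ℕ` is strictly monotone for the order and
`rank w ≤ rank u + β` across every edge, every higher fill-neighbourhood has at most `β` vertices,
so `elimWidth G ≤ β`. [folklore] -/
theorem elimWidth_le_of_bandwidth (rank : V → ℕ) (hmono : StrictMono rank) (β : ℕ)
    (hband : ∀ u w, G.Adj u w → rank w ≤ rank u + β) : elimWidth G ≤ β := by
  classical
  refine Finset.sup_le fun v _ => ?_
  -- the fill neighbourhood lies in the rank-interval `(rank v, rank v + β]`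
  have hsub : higherAdj (elimGraph G).Adj v ⊆ ↑((Finset.Ioc (rank v) (rank v + β)).preimage rank
      (hmono.injective.injOn)) := by
    intro w hw
    obtain ⟨hvw, u, huv, huw⟩ := exists_adj_le_of_mem_higherAdj hw
    rw [Finset.coe_preimage, Set.mem_preimage, Finset.mem_coe, Finset.mem_Ioc]
    exact ⟨hmono hvw, (hband u w huw).trans (Nat.add_le_add_right (hmono.monotone huv) β)⟩
  calc (higherAdj (elimGraph G).Adj v).ncard
      ≤ (↑((Finset.Ioc (rank v) (rank v + β)).preimage rank hmono.injective.injOn) : Set V).ncard :=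
        Set.ncard_le_ncard hsub (Set.toFinite _)
    _ = ((Finset.Ioc (rank v) (rank v + β)).preimage rank hmono.injective.injOn).card :=
        Set.ncard_coe_finset _
    _ ≤ (Finset.Ioc (rank v) (rank v + β)).card :=
        Finset.card_le_card_of_injOn rank (fun w hw => (Finset.mem_preimage.mp hw))
          hmono.injective.injOn
    _ = β := by simp

end Bandwidth

/-! ## 2. The folded raster labelling of the torus -/

section Folded

variable {d L : ℕ}

/-- The FOLDING of `ℤ/L`: `φ(t) = 2t` if `2t ≤ L-1`, else `2(L-1-t)+1` — the inverse of the
enumeration `0, L-1, 1, L-2, 2, …`, under which cyclic neighbours get labels at distance `≤ 2`.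
[folklore] -/
def foldVal (L : ℕ) (t : ZMod L) : ℕ :=
  if 2 * t.val ≤ L - 1 then 2 * t.val else 2 * (L - 1 - t.val) + 1

/-- `φ(t) < L`. [folklore] -/
theorem foldVal_lt [NeZero L] (t : ZMod L) : foldVal L t < L := by
  have ht := ZMod.val_lt t
  unfold foldVal
  split_ifs with h <;> omega

/-- `φ` is injective. [folklore] -/
theorem foldVal_injective [NeZero L] : Function.Injective (foldVal L) := by
  intro s t hst
  have hs := ZMod.val_lt s
  have ht := ZMod.val_lt t
  apply ZMod.val_injective
  unfold foldVal at hst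
  split_ifs at hst with h1 h2 h2 <;> omega

/-- **Cyclic neighbours fold to labels at distance `≤ 2`**: `|φ(t+1) - φ(t)| ≤ 2` for every
`t : ℤ/L`, `L ≥ 2` (including the wrap `t = L-1`). [folklore] -/
theorem foldVal_add_one_dist_le [NeZero L] (hL : 2 ≤ L) (t : ZMod L) :
    foldVal L (t + 1) ≤ foldVal L t + 2 ∧ foldVal L t ≤ foldVal L (t + 1) + 2 := by
  have ht := ZMod.val_lt t
  have hval : (t + 1 : ZMod L).val = if t.val + 1 < L then t.val + 1 else 0 := by
    split_ifs with h
    · rw [ZMod.val_add, ZMod.val_one'' (by omega), Nat.mod_eq_of_lt h]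
    · rw [ZMod.val_add, ZMod.val_one'' (by omega), Nat.mod_eq_zero_of_dvd]
      exact ⟨1, by omega⟩
  unfold foldVal
  rw [hval]
  split_ifs <;> omega

/-- The FOLDED RASTER labelling `rank x = Σ_i φ(x_i)·L^i` of the torus, through
`finFunctionFinEquiv` (so it is a bijection onto `{0,…,L^d-1}`). [folklore] -/
def foldedRank [NeZero L] (x : TorusSite d L) : ℕ :=
  finFunctionFinEquiv (fun i => (⟨foldVal L (x i), foldVal_lt (x i)⟩ : Fin L))

/-- `rank x = Σ_i φ(x_i)·L^i`. [folklore] -/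
theorem foldedRank_eq [NeZero L] (x : TorusSite d L) :
    foldedRank x = ∑ i : Fin d, foldVal L (x i) * L ^ (i : ℕ) := by
  rw [foldedRank, finFunctionFinEquiv_apply]

/-- The folded raster labelling is injective. [folklore] -/
theorem foldedRank_injective [NeZero L] : Function.Injective (foldedRank (d := d) (L := L)) := by
  intro x y hxy
  have h := finFunctionFinEquiv.injective (Fin.ext hxy)
  funext i
  have hi := congr_fun h i
  simp only [Fin.mk.injEq] at hi
  exact foldVal_injective hi

/-- **Bandwidth of the folded raster labelling**: across a torus edge in direction `i` the label
moves by at most `2·L^i ≤ 2·L^{d-1}`. [folklore] -/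
theorem foldedRank_adj_le [NeZero L] (hL : 2 ≤ L) {u w : TorusSite d L}
    (huw : (torusGraph d L).Adj u w) : foldedRank w ≤ foldedRank u + 2 * L ^ (d - 1) := by
  -- `w = u + e_i` or `u = w + e_i`
  have key : ∀ x : TorusSite d L, ∀ i : Fin d,
      foldedRank (x + Pi.single i 1) ≤ foldedRank x + 2 * L ^ (d - 1) ∧
        foldedRank x ≤ foldedRank (x + Pi.single i 1) + 2 * L ^ (d - 1) := by
    intro x i
    have hsplit : ∀ y : TorusSite d L, foldedRank y =
        foldVal L (y i) * L ^ (i : ℕ) + ∑ j ∈ univ.erase i, foldVal L (y j) * L ^ (j : ℕ) := by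
      intro y
      rw [foldedRank_eq, ← Finset.add_sum_erase _ _ (mem_univ i)]
    have hrest : ∑ j ∈ univ.erase i, foldVal L ((x + Pi.single i (1 : ZMod L) : TorusSite d L) j)
        * L ^ (j : ℕ) = ∑ j ∈ univ.erase i, foldVal L (x j) * L ^ (j : ℕ) := by
      refine Finset.sum_congr rfl fun j hj => ?_
      rw [Pi.add_apply, Pi.single_eq_of_ne (Finset.ne_of_mem_erase hj), add_zero]
    have hxi : (x + Pi.single i (1 : ZMod L) : TorusSite d L) i = x i + 1 := by simp
    have hpow : L ^ (i : ℕ) ≤ L ^ (d - 1) :=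
      Nat.pow_le_pow_right (by omega) (by have := i.isLt; omega)
    obtain ⟨h1, h2⟩ := foldVal_add_one_dist_le hL (x i)
    have h2pow := Nat.mul_le_mul_left 2 hpow
    have e1 : foldVal L (x i + 1) * L ^ (i : ℕ) ≤ foldVal L (x i) * L ^ (i : ℕ) + 2 * L ^ (d - 1) :=
      calc foldVal L (x i + 1) * L ^ (i : ℕ) ≤ (foldVal L (x i) + 2) * L ^ (i : ℕ) :=
            Nat.mul_le_mul_right _ h1
        _ = foldVal L (x i) * L ^ (i : ℕ) + 2 * L ^ (i : ℕ) := by ring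
        _ ≤ foldVal L (x i) * L ^ (i : ℕ) + 2 * L ^ (d - 1) := by omega
    have e2 : foldVal L (x i) * L ^ (i : ℕ) ≤ foldVal L (x i + 1) * L ^ (i : ℕ) + 2 * L ^ (d - 1) :=
      calc foldVal L (x i) * L ^ (i : ℕ) ≤ (foldVal L (x i + 1) + 2) * L ^ (i : ℕ) :=
            Nat.mul_le_mul_right _ h2
        _ = foldVal L (x i + 1) * L ^ (i : ℕ) + 2 * L ^ (i : ℕ) := by ring
        _ ≤ foldVal L (x i + 1) * L ^ (i : ℕ) + 2 * L ^ (d - 1) := by omega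
    rw [hsplit (x + Pi.single i 1), hsplit x, hrest, hxi]
    constructor <;> omega
  obtain ⟨-, ⟨i, rfl⟩ | ⟨i, rfl⟩⟩ := (torusGraph_adj_iff u w).mp huw
  · exact (key u i).1
  · exact (key w i).2

/-- The FOLDED RASTER ORDER on the sites of the torus: `x < y ↔ rank x < rank y`. [folklore] -/
@[reducible] noncomputable def foldedRasterOrder (d L : ℕ) [NeZero L] : LinearOrder (TorusSite d L) :=
  LinearOrder.lift' (foldedRank (d := d) (L := L)) foldedRank_injective

/-- **THE FOLDED RASTER ORDER HAS ELIMINATION WIDTH `≤ 2·L^{d-1}`**: every site of `(ℤ/L)^d` has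
at most `2·L^{d-1}` higher fill-neighbours in this order (`L ≥ 2`) — an exact autoregressive
sampler visiting the sites in (reverse) folded raster order needs context `≤ 2·L^{d-1}` for any
target that is Markov with respect to the torus graph. [folklore] -/
theorem torus_elimWidth_foldedRaster_le [NeZero L] (hL : 2 ≤ L) :
    @elimWidth (TorusSite d L) (foldedRasterOrder d L) _ (torusGraph d L) ≤ 2 * L ^ (d - 1) := by
  letI : LinearOrder (TorusSite d L) := foldedRasterOrder d L
  refine elimWidth_le_of_bandwidth foldedRank (fun x y hxy => ?_) (2 * L ^ (d - 1))
    fun u w huw => foldedRank_adj_le hL huw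
  exact hxy

/-- **`tw((ℤ/L)^d) ≤ 2·L^{d-1}`** (`L ≥ 2`). [folklore] -/
theorem torus_treewidth_le [NeZero L] (hL : 2 ≤ L) :
    treewidth (torusGraph d L) ≤ 2 * L ^ (d - 1) := by
  letI : LinearOrder (TorusSite d L) := foldedRasterOrder d L
  exact treewidth_le_elimWidth.trans (torus_elimWidth_foldedRaster_le hL)

end Folded

end Summit.Ventures.LatticeQCDFlow.Theory2.Autoregressive
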